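import Literature.NumberTheory.EllipticCurves.KrizLi2019.HeegnerLogCongruence
import Literature.NumberTheory.EllipticCurves.PAdicHeights
import Literature.NumberTheory.LFunctions.GeneralizedBernoulliNumbers
import Literature.NumberTheory.QuadraticFields.PadicQuadraticLattices
import Mathlib.NumberTheory.DirichletCharacter.Basic
import HarnessLib

/-!
# Kriz–Li 2019, Theorem 1.20 (= Theorem 7.1, first alternative): at an odd EISENSTEIN prime `p`
# the `p`-adic logarithm of the Heegner point is a unit when two generalised Bernoulli numbers are

Trunk `Literature/NumberTheory/EllipticCurves`, story `KrizLi2019/` (D. Kriz, C. Li, *Goldfeld's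
conjecture and congruences between Heegner points*, Forum Math. Sigma **7** (2019) e15, 80 pp.,
doi 10.1017/fms.2019.9, open access; bib `KrizLi2019`; the journal text MERGES arXiv:1606.03172 and
arXiv:1609.06687 *Heegner points at Eisenstein primes and twists of elliptic curves*). Companion of
`HeegnerLogCongruence.lean` (Thm. 1.16, the congruence between TWO curves) in the SAME currency:
`Castella2018.padicLogOmega` (Néron-normalised `ℤ_p`-linear formal logarithm read through an
embedding `ιp : K →+* ℚ_p`), the constant `D.maninConstant` of a modular parametrisation
(`log_{ω_E} = log_{ω_𝓔}/c`, Rem. 3.10), `nsPointCount W p = |Ẽ^{ns}(𝔽_p)|` (Rem. 1.17),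
`SatisfiesHeegnerHypothesis`, `HeegnerDatum`, `heegnerPointComplex`. Requested by the cell `bsd-cm`
(run/shared/lean/pub/bsd-cm/, TARGET v4 §8 W15; seat `bsd-cm-ram`, memo `ROUTE-U.md` §3/§10 K-c):
it is the binder `hKL` of their "Theorem U" (the unit case of residual class O11 at `p = 7` for the
quadratic twists of `X₀(49)`), where `p = 7` is ADDITIVE (CM-ramified) for the curve — allowed by
the printed theorem: FMS p. 42, "Our generalization, in particular, does not require `p ∤ N`", and
Rem. 1.21 (the case of CM by `ℚ(√−p)`); Kriz–Li themselves apply Thm. 7.1 at the additive prime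
`3` of `y² = x³ − 432d` (Thm. 10.6, FMS p. 69: "noting that `|Ẽ^{ns}_d(𝔽₃)| = 3` since `E_d` has
additive reduction at `3`"). ONE named fact (`def … : Prop`, nothing asserted; D-0014/D-0026
accounting: +1, consumer named), six small definitions with bodies (the READINGS of the printed
symbols `ω`, `ε_K`, `ψ₀`, `ψ₁ψ₂`, `B_{1,ψ}` on Mathlib's `DirichletCharacter` and the tree's
`generalizedBernoulli`), and proved API. No `sorry`.

## The printed statement (publisher PDF, `lit read` of the Cambridge Core PDF → store key
## `paper:url-be4c8b95ec35`, 80 pages = journal pages; p. 7 L36 – p. 8 L9), VERBATIM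

§1.5 (p. 7): "for a finite order Galois character `ψ : G_ℚ → ℚ̄^×`, we abuse notation and denote by
`ψ : (ℤ/fℤ)^× → ℂ^×` the corresponding Dirichlet character, where `f` is its conductor. The
generalized (first) Bernoulli number is defined to be `B_{1,ψ} := (1/f) ∑_{m=1}^{f} ψ(m) m`. (1)
Let `ε_K` be the quadratic character associated with `K`. We consider the even Dirichlet character
`ψ₀ := ψ` if `ψ` is even, `ψ ε_K` if `ψ` is odd.

THEOREM 1.20 (Theorem 7.1). Let `E/ℚ` be an elliptic curve of conductor `N`. Suppose `p` is an odd
prime such that `E[p]` is a reducible `G_ℚ`-representation. Write `E[p]^{ss} ≅ 𝔽_p(ψ) ⊕ 𝔽_p(ψ⁻¹ω)`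
for some character `ψ : G_ℚ → Aut(𝔽_p) ≅ μ_{p−1}` and the mod `p` cyclotomic character `ω`. Assume
that (1) `ψ(p) ≠ 1` and `(ψ⁻¹ω)(p) ≠ 1`; (2) `E` has no primes of split multiplicative reduction;
(3) If `ℓ ≠ p` is an additive prime for `E`, then `ψ(ℓ) ≠ 1` and `(ψ⁻¹ω)(ℓ) ≠ 1`.
Let `K` be an imaginary quadratic field satisfying the Heegner hypothesis for `N`. Let `P ∈ E(K)`
be the associated Heegner point. Assume `p` splits in `K`. Assume
`B_{1,ψ₀⁻¹ε_K} · B_{1,ψ₀ω⁻¹} ≠ 0 (mod p)`. Then `(|Ẽ^{ns}(𝔽_p)|/p) · log_{ω_E} P ≠ 0 (mod p)`.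
In particular, `P ∈ E(K)` is of infinite order and `E/K` has analytic and algebraic rank `1`."

Conventions it relies on (FMS §2, pp. 11–12): "All Dirichlet (that is, finite order) characters
`ψ : 𝔸_ℚ^× → ℚ̄^×` will be primitive, and we denote the conductor by `f(ψ)` … Following convention,
we extend `ψ` to `ℤ/f(ψ) → ℚ̄`, defining `ψ(a) = 0` if `(a, f(ψ)) ≠ 1`. Given Dirichlet characters
`ψ₁` and `ψ₂`, we let `ψ₁ψ₂` denote the unique primitive Dirichlet character such that
`ψ₁ψ₂(a) = ψ₁(a)ψ₂(a)` for all `a ∈ ℤ` with `(a, f(ψ)) = 1`. … We will often identify a Dirichlet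
character … with its associated Galois character … using the arithmetic normalization (… `Frob_ℓ`
… gets sent to the idèle which is `ℓ` at the place … `ℓ` and `1` at all other places). Throughout,
for a given `p`, let `ω : Gal(ℚ̄/ℚ) → μ_{p−1}` denote the mod `p` cyclotomic character. …
`ε_K : (ℤ/d_K)^× → μ₂` be the quadratic character associated with `K`. … Throughout, let `E/ℚ` be
an elliptic curve of conductor `N = N_{split}N_{nonsplit}N_{add}`". §1.4 (p. 4): `K = ℚ(√d_K)` of
fundamental discriminant `d_K` with "each prime factor `ℓ` of `N` is split in `K`"; `P ∈ E(K)`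
"defined up to sign and torsion with respect to a fixed modular parametrization `π_E : X₀(N) → E`";
`ω_E` with `π_E^*(ω_E) = f(q) dq/q`, "`ω_E` may differ from the Néron differential by a scalar
when `E` is not the optimal curve". Rem. 1.17 (p. 6): `|Ẽ^{ns}(𝔽_ℓ)| = ℓ + 1 − a_ℓ(E)`, `ℓ ± 1`,
`ℓ` according as `ℓ ∤ N`, `ℓ ∥ N`, `ℓ² ∣ N`. THEOREM 7.1 (pp. 42–43) is the same statement with
"(2) `N_{split} = 1`", "(3) `ℓ ≠ p`, `ℓ ∣ N_{add}` implies either `ψ(ℓ) ≠ 1` and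
`ℓ ≢ ψ(ℓ) (mod p)`, or `ψ(ℓ) = 0`", "(4) `p ∤ B_{1,ψ₀⁻¹ε_K} · B_{1,ψ₀ω⁻¹}`", plus a second
alternative for `ψ = 1` (any `p`, `p ∣ N`, `ord_p((p−1)/(2p) · log_p ᾱ) = 0`) NOT vendored here.
Its proof is the main congruence (29) (p. 49–50):
`(|Ẽ^{ns}(𝔽_p)|/p) · log_{ω_E} P ≡ ± ∏_{ℓ∣N₊,ℓ≠p}(1−ψ⁻¹(ℓ)) ∏_{ℓ∣N₋,ℓ≠p}(1−ψ(ℓ)/ℓ)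
∏_{ℓ∣N₀,ℓ≠p}(1−ψ⁻¹(ℓ))(1−ψ(ℓ)/ℓ) · ¼(1−ψ⁻¹(p))(1−(ψω⁻¹)(p)) B_{1,ψ₀⁻¹ε_K} B_{1,ψ₀ω⁻¹}
(mod p𝒪_{ℂ_p})`, "from studying when the right-hand side … vanishes mod `p`".

Versions (for the referee): arXiv:1609.06687v3 (the authors' LaTeX `Eisenstein.tex`, ll. 356–366
`thm:mainthm`, ll. 481–505 `thm:Heegnercorollary`) states Thm. 7.1 for `GL₂`-type abelian
varieties with an extra condition "(3) `p² ∤ f(ψ₀)` if `p > 2`", automatic for elliptic curves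
(its Remark `remark:ellipticcurve`); the store's text `paper:arxiv-1609.06687` is an EARLIER arXiv
version whose §1 adds "For simplicity, we also assume that `d_K ≠ −3, −4` … and that `d_K` is odd"
(chunk p0004 L5) — a sentence absent from v3 and from the journal §1.4/§2; we transcribe the
JOURNAL statement (no restriction on `d_K` beyond "`p` splits", which excludes `d_K = −3` only when
`p = 3`). The s2orc text `paper:doi-10-1017-fms-2019-9` drops `≠` and displays; do not read the
hypotheses from it.

## Transcription (tree vocabulary; every hypothesis a binder)

* `E` = a GLOBALLY MINIMAL model `W /ℚ` (`[IsGloballyMinimal]`, so the reduction predicates and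
  `nsPointCount` are the curve's), `N = W.conductorNorm ℤ`, `a_ℓ(E) = W.LFunction ℓ` (as in
  `HeegnerLogCongruence.lean`). "`p` odd prime": `[Fact p.Prime]`, `p ≠ 2`.
* "`ψ : G_ℚ → Aut(𝔽_p) ≅ μ_{p−1}`", a PRIMITIVE Dirichlet character of conductor `f` (§2
  conventions, arithmetic Frobenius): `ψ : DirichletCharacter ℚ_[p] f`, `ψ.IsPrimitive`; its values
  are automatically in `μ_{p−1} ⊂ ℤ_p^×` (the roots of unity of `ℚ_p`, `p` odd) — the fixed
  embedding `ℚ̄ ↪ ℚ̄_p` of §2 read on `μ_{p−1}`. Mathlib's `MulChar` already extends by `0` off the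
  units ("`ψ(a) = 0` if `(a, f(ψ)) ≠ 1`").
* "the mod `p` cyclotomic character `ω`" as a Dirichlet character = the Teichmüller character
  (`ω(a) ≡ a (mod p)`, `ω(a)^{p−1} = 1`; Washington §5.1): a binder `ω : DirichletCharacter ℚ_[p] p`
  with `IsTeichmullerCharacter ω` (below) — the congruence pins `ω` down uniquely (distinct
  `(p−1)`-th roots of unity are incongruent mod `p`); under the arithmetic normalisation
  `ω(Frob_ℓ) = ω(ℓ) ≡ ℓ`.
* "`E[p]^{ss} ≅ 𝔽_p(ψ) ⊕ 𝔽_p(ψ⁻¹ω)`" transcribed, exactly as `HeegnerLogCongruence.lean`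
  transcribes "`E[p^m]^{ss} ≅ E′[p^m]^{ss}`", by TRACES OF FROBENIUS at the primes `ℓ ∤ pN`
  (where both sides are unramified): `a_ℓ(E) ≡ ψ(ℓ) + ψ⁻¹(ℓ)ω(ℓ) (mod p)`, i.e.
  `‖a_ℓ − (ψ(ℓ) + ψ⁻¹(ℓ)ω(ℓ))‖_p < 1`. Equivalent to the printed hypothesis (Chebotarev +
  Brauer–Nesbitt, both determinants being `ω`); a `ψ` ramified at some `ℓ ∤ pN` cannot satisfy it
  (`ψ(ℓ) = 0` there) — as it cannot occur in print (`E[p]` is unramified outside `pN`). This is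
  also the form the proof uses (§7.1, Lemma 7.4: "`a_ℓ(f) ≡ ψ(ℓ)`, `≡ ψ⁻¹(ℓ)ℓ`", the Eisenstein
  congruence away from the bad primes). -- TODO(general form): the `ψ = 1` alternative of Thm. 7.1
  (`p ∣ N`, `ord_p((p−1)/(2p) log_p ᾱ) = 0`) and the `GL₂`-type version of arXiv v3.
* "(1) `ψ(p) ≠ 1` and `(ψ⁻¹ω)(p) ≠ 1`": `ψ (p : ZMod f) ≠ 1` and `primVal (invMulOmega ψ ω) p ≠ 1`,
  `primVal χ a` = the value at `a` of the PRIMITIVE character inducing `χ` (§2: "`ψ₁ψ₂` denote the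
  unique primitive Dirichlet character …"), `invMulOmega ψ ω = ψ⁻¹ω` computed at level `f·p`.
* "(2) no primes of split multiplicative reduction": `¬ W.HasSplitMultiplicativeReductionAtPrime ℓ`
  for every prime `ℓ` (`PAdicHeights.lean`). "(3) `ℓ ≠ p` additive": `¬ HasGoodReductionAtPrime ℓ ∧
  ¬ HasMultiplicativeReductionAtPrime ℓ` (the tree's `Rank1Residual.Addv`, inlined to keep imports
  small).
* `K`, Heegner hypothesis, "`p` splits in `K`", `ιp`, `D : ModularParametrizationData W N`,
  `H : HeegnerDatum N d_K`, `ι : K →+* ℂ`, `P` with `ι(P) = heegnerPointComplex D H`: LITERALLY the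
  binders of `thm116_padicLogHeegner_congruence`. `ε_K`: a binder
  `εK : DirichletCharacter ℚ_[p] |d_K|` with `IsKroneckerCharacterOf K εK` (primitive, and
  `ε_K(ℓ) = +1 / −1` according as the prime `ℓ ∤ d_K` splits / is inert in `K` — which pins `ε_K`
  down). `ψ₀ = evenTwist ψ εK` (level `f·|d_K|`), `ψ₀⁻¹ε_K = bernoulliCharOne ψ εK`,
  `ψ₀ω⁻¹ = bernoulliCharTwo ψ εK ω` (level `f·|d_K|·p`), and `B_{1,χ}` OF THE PRIMITIVE character
  inducing `χ` = `bernoulliOnePrim χ` = the tree's `generalizedBernoulli 1` (Diamond–Shurman (4.30))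
  of `χ.primitiveCharacter`; for a non-trivial character this IS the printed (1)
  (`generalizedBernoulli_one_eq_sum_div`, proved below; both characters here are odd, hence
  non-trivial).
* "`x ≠ 0 (mod p)`" / "`≠ 0 (mod p𝒪_{K_p})`", `K_p = ℚ_p`: LITERALLY `¬ (‖x‖_p ≤ p⁻¹)` (`x ∉ p𝒪`),
  for the Bernoulli hypothesis AND for the conclusion — the same reading of "`(mod p)`" as
  `HeegnerLogCongruence.lean` (`‖x − y‖ ≤ p⁻¹`). In the theorem's setting both quantities are in
  fact `p`-integral (Lemma 8.1 / Cor. 8.4 for the Bernoulli numbers; the congruence (29) for the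
  left side), so "`≠ 0 (mod p)`" means "is a `p`-adic unit"; integrality is NOT part of the printed
  display and is not added (once `‖x‖ ≤ 1` is known, the tree's
  `Literature.NumberTheory.QuadraticFields.PadicQuadratic.norm_eq_one_of_not_le`
  (`PadicQuadraticLattices.lean`) turns `¬ ‖x‖ ≤ p⁻¹` into `‖x‖ = 1`).
  `log_{ω_E} P = padicLogOmega W p ιp P / D.maninConstant`,
  `|Ẽ^{ns}(𝔽_p)| = nsPointCount W p` (Rem. 1.17; `= p` at an additive `p`).
* "In particular, `P` is of infinite order …": a consequence (formal group + Gross–Zagier–Kolyvagin),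
  not restated inside the fact; `padicLogOmega_ne_zero_of_thm120` below extracts `log_{ω_𝓔} P ≠ 0`.

§4 (appended, bsd-cm TARGET v4.5 §2 T-U2 binder `hint` / §8 W18): the INTEGRALITY half of "is a
`p`-adic unit" is printed separately as **Remark 3.10** (FMS p. 26): "`(|Ẽ^{ns}(𝔽_p)|/p) · log_{ω_E} P`
is `p`-integral" in the setting of Thm. 1.16 — vendored as the second named fact
`rem310_padicLogHeegner_integral` (a REMARK in print, labelled so), with the proved corollaries
`norm_eq_one_of_rem310` (Rem. 3.10 ∧ "`≢ 0 (mod p)`" ⇒ `‖x‖ = 1`, via the tree's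
`PadicQuadratic.norm_eq_one_of_not_le`) and `padicLogOrd_eq_of_norm_eq_one` (the same in `ord_p`
bookkeeping: `ord_p |Ẽ^{ns}(𝔽_p)| − 1 + ord_p log_{ω_𝓔} P = ord_p c`).

§5 (appended, bsd-cm TARGET v4.6 §2 T-U3′): the Teichmüller binder modulo `p²` — PROVED
`apply_pow_sub_one_eq_one` (`ω(a)^{p−1} = 1`), `norm_apply_eq_one`, and
`IsTeichmullerCharacter.norm_pow_sub_pow_le` / `norm_sub_pow_le` (`‖ω(a)^k − a^{pk}‖ ≤ p⁻²`), the
bridge to the elementary mod-`p²` form of the Bernoulli hypothesis.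

§6 (appended, cell `bsd-print-cfram` (D-0131 (2) PRINT tier, leaf CornerF ∧ CM-ramified `p`), seat
ty1; closes the `TODO(general form)` above for ODD `p`): **Theorem 7.1, SECOND alternative
(`ψ = 1`)** as the named fact `thm71_padicLogHeegner_unit_of_trivialChar`, in the same currency
and with the same conclusion as `thm120_…`: hypotheses (1) `ψ = 1` (trace form
`a_ℓ(W) ≡ 1 + ℓ (mod p)` at `ℓ ∤ pN`), (2) `p ∣ N`, (3) `ℓ ∣ N, ℓ ≠ p ⟹ ℓ ∥ N, ℓ ≡ −1, ℓ ≢ 1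
(mod p)`, (4) `ord_p(((p−1)/(2p)) · log_p ᾱ) = 0`, `(α) = 𝔭^{h_K}`, `log_p` the Iwasawa logarithm
(the tree's `padicLog p` on `ℚ_p`, read through `ιp`), PLUS the two clauses the printed PROOF uses
and the display omits — `d_K < −4` (p. 49 L41, formula (28)) and «`ℓ ∤ N₊`», i.e. no prime
`ℓ ≠ p` of split multiplicative reduction (Lemma 7.7's proof, p. 51 L6–9, with Lemma 7.4 (2)) — so
that the typed fact is NOT STRONGER than what is proved (both additions only weaken it; both are
vacuous for the consumer: CM curves have no multiplicative prime, and `p = 3` split in `K` forces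
`d_K ∉ {−3, −4}`). Consumer: the `j = 0` curves of `3`-power conductor at `p = 3` (class 243a of the
cell's window, where `ψ` is trivial and Thm. 1.20's hypothesis (1) fails — prover census
2026-08-27), via a Route-U-type theorem. Two proved API lemmas (`traceForm_one_of_dvd`,
`norm_prefactor_mul_eq_one_iff`). +1 named fact (PUBLISHED, refereed), nothing asserted.

FIDELITY NOTE for the consumer (bsd-cm W15 / ROUTE-U §3): at `W = 49a1^{(D)}`, `p = 7`, the two
isogeny characters are `ω²χ_D` and `ω⁵χ_D`; whichever is called `ψ`, hypotheses (1)–(3) and the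
Bernoulli pair are symmetric under `ψ ↔ ψ⁻¹ω` (FMS §7.1: "We may assume without loss of generality
that `ψ ≠ ω` (otherwise, interchange `ψ` and `ψ⁻¹ω`)"). Nothing is asserted here: users take
`(h : thm120_padicLogHeegner_unit_of_bernoulli)`.
-/

noncomputable section

open scoped Classical

open NumberField WeierstrassCurve Literature.NumberTheory.EllipticCurves
  Literature.NumberTheory.EllipticCurves.ModularForms Literature.NumberTheory.LFunctions

namespace Literature.NumberTheory.EllipticCurves.KrizLi2019

/-! ### §1 Readings of the printed symbols `ω`, `ε_K`, `ψ₀`, `ψ₁ψ₂(a)`, `B_{1,ψ}` -/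

section Symbols

variable {p : ℕ} [Fact p.Prime] {f d n : ℕ}

/-- **"the mod `p` cyclotomic character `ω : Gal(ℚ̄/ℚ) → μ_{p−1}`" read as a Dirichlet character
modulo `p` with values in `ℚ_p`** (FMS §2, p. 12; arithmetic normalisation `Frob_ℓ ↦ ℓ`): the
Teichmüller character, i.e. the character with `ω(a) ≡ a (mod p)` for every integer `a` prime to
`p` (Washington, *Cyclotomic Fields*, §5.1: "`ω(a) ≡ a mod p`"). The congruence determines `ω`
(the values are `(p−1)`-th roots of unity, pairwise incongruent modulo `p`). A predicate on a
candidate `ω` (the prime `p` is read off the type of `ω`); nothing asserted.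
[cite: Washington1997, §5.1 (the Teichmüller character `ω`)] -/
def IsTeichmullerCharacter (ω : DirichletCharacter ℚ_[p] p) : Prop :=
  ∀ a : ℤ, ¬ ((p : ℤ) ∣ a) → ‖ω (a : ZMod p) - (a : ℚ_[p])‖ < 1

/-- **"`ε_K : (ℤ/d_K)^× → μ₂` the quadratic character associated with `K`"** (FMS §2, p. 12), read
on a candidate Dirichlet character `εK` modulo `|d_K|` with values in `ℚ_p`: `εK` is primitive (all
characters of the paper are, §2) and at every prime `ℓ ∤ d_K` its value is `+1` if `ℓ` splits in
`K` (two primes of `𝓞 K` above `ℓ`, the idiom of `SatisfiesHeegnerHypothesis`) and `−1` otherwise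
(`ℓ` inert) — the Kronecker symbol `(d_K/ℓ)`, which determines `εK`. A predicate; nothing asserted.
[cite: KrizLi2019, §2 (p. 12, "the quadratic character associated with K")] -/
def IsKroneckerCharacterOf (K : Type) [Field K] [NumberField K]
    (εK : DirichletCharacter ℚ_[p] (NumberField.discr K).natAbs) : Prop :=
  εK.IsPrimitive ∧
    ∀ ℓ : ℕ, ℓ.Prime → ¬ ((ℓ : ℤ) ∣ NumberField.discr K) →
      εK (ℓ : ZMod (NumberField.discr K).natAbs) =
        if ((Ideal.span {(ℓ : ℤ)}).primesOver (𝓞 K)).ncard = 2 then 1 else -1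

/-- **`ψ₀ := ψ` if `ψ` is even, `ψ ε_K` if `ψ` is odd** (FMS §1.5 p. 7 and §2 p. 12, "the even
Dirichlet character"), computed at the common level `f · |d_K|` (Mathlib `changeLevel`; the paper's
`ψε_K` is the PRIMITIVE character inducing this product — primitivity is restored by
`bernoulliOnePrim` / `primVal` where values are taken). A definition; nothing asserted.
[cite: KrizLi2019, §1.5 (p. 7, display defining ψ₀)] -/
def evenTwist (ψ : DirichletCharacter ℚ_[p] f) (εK : DirichletCharacter ℚ_[p] d) :
    DirichletCharacter ℚ_[p] (f * d) :=
  if ψ.Even then DirichletCharacter.changeLevel (dvd_mul_right f d) ψ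
  else DirichletCharacter.changeLevel (dvd_mul_right f d) ψ *
    DirichletCharacter.changeLevel (dvd_mul_left d f) εK

/-- **The character `ψ₀⁻¹ ε_K`** of the first Bernoulli number of Thm. 1.20, at level `f · |d_K|`
(before passing to the primitive character it induces). A definition; nothing asserted.
[cite: KrizLi2019, Thm. 1.20 (p. 8, the Bernoulli hypothesis)] -/
def bernoulliCharOne (ψ : DirichletCharacter ℚ_[p] f) (εK : DirichletCharacter ℚ_[p] d) :
    DirichletCharacter ℚ_[p] (f * d) :=
  (evenTwist ψ εK)⁻¹ * DirichletCharacter.changeLevel (dvd_mul_left d f) εK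

/-- **The character `ψ₀ ω⁻¹`** of the second Bernoulli number of Thm. 1.20, at level `f · |d_K| · p`
(before passing to the primitive character it induces). A definition; nothing asserted.
[cite: KrizLi2019, Thm. 1.20 (p. 8, the Bernoulli hypothesis)] -/
def bernoulliCharTwo (ψ : DirichletCharacter ℚ_[p] f) (εK : DirichletCharacter ℚ_[p] d)
    (ω : DirichletCharacter ℚ_[p] p) : DirichletCharacter ℚ_[p] (f * d * p) :=
  DirichletCharacter.changeLevel (dvd_mul_right (f * d) p) (evenTwist ψ εK) *
    DirichletCharacter.changeLevel (dvd_mul_left p (f * d)) ω⁻¹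

/-- **The character `ψ⁻¹ω`** of hypotheses (1) and (3) of Thm. 1.20, at level `f · p` (before
passing to the primitive character it induces). A definition; nothing asserted.
[cite: KrizLi2019, Thm. 1.20 (p. 7, hypotheses (1) and (3))] -/
def invMulOmega (ψ : DirichletCharacter ℚ_[p] f) (ω : DirichletCharacter ℚ_[p] p) :
    DirichletCharacter ℚ_[p] (f * p) :=
  DirichletCharacter.changeLevel (dvd_mul_right f p) ψ⁻¹ *
    DirichletCharacter.changeLevel (dvd_mul_left p f) ω

/-- **`(ψ₁ψ₂)(a)`: the value at the natural number `a` of the PRIMITIVE character inducing `χ`**,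
extended by `0` to the non-units of `ℤ/f(ψ₁ψ₂)` (FMS §2, p. 11: "`ψ₁ψ₂` denote the unique
primitive Dirichlet character such that `ψ₁ψ₂(a) = ψ₁(a)ψ₂(a)` for all `a` with `(a, f) = 1`" and
"`ψ(a) = 0` if `(a, f(ψ)) ≠ 1`"; Mathlib `DirichletCharacter.primitiveCharacter`, of level
`χ.conductor`). A definition; nothing asserted. [cite: KrizLi2019, §2 (p. 11, conventions on primitive characters)] -/
def primVal (χ : DirichletCharacter ℚ_[p] n) (a : ℕ) : ℚ_[p] :=
  χ.primitiveCharacter (a : ZMod χ.conductor)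

/-- **`B_{1,χ̃}` of the PRIMITIVE character `χ̃` inducing `χ`** (all characters of the paper are
primitive, §2), with `B_{1,·}` the tree's generalised Bernoulli number `generalizedBernoulli 1`
(Diamond–Shurman (4.30): `∑_{c mod f} χ̃(c) B₁(c/f)`, `B₁(X) = X − ½`), which for a NON-TRIVIAL
character is the printed (1) `B_{1,χ̃} = (1/f) ∑_{m=1}^{f} χ̃(m) m`
(`generalizedBernoulli_one_eq_sum_div`). The level `n ≠ 0` guarantees `χ.conductor ≠ 0`. A
definition; nothing asserted. [cite: KrizLi2019, §1.5 display (1) (p. 7)] -/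
def bernoulliOnePrim [NeZero n] (χ : DirichletCharacter ℚ_[p] n) : ℚ_[p] :=
  haveI : NeZero χ.conductor := ⟨χ.conductor_ne_zero⟩
  generalizedBernoulli 1 χ.primitiveCharacter

end Symbols

/-! ### §2 The named fact: Theorem 1.20 (= Theorem 7.1, first alternative) -/

section Fact

/-- **Kriz–Li 2019, Theorem 1.20 (= Theorem 7.1, the `ψ ≠ 1` alternative): non-vanishing mod `p`
of the `p`-adic logarithm of the Heegner point at an odd Eisenstein prime, from two Bernoulli
numbers.** For an odd prime `p`; a globally minimal elliptic curve `W/ℚ` of conductor `N`; a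
primitive Dirichlet character `ψ` of conductor `f` with values in `ℚ_p` (so in `μ_{p−1}`) and the
Teichmüller character `ω` mod `p`, such that `E[p]^{ss} ≅ 𝔽_p(ψ) ⊕ 𝔽_p(ψ⁻¹ω)` in the trace form
`a_ℓ(W) ≡ ψ(ℓ) + ψ⁻¹(ℓ)ω(ℓ) (mod p)` for every prime `ℓ ∤ pN`; assuming (1) `ψ(p) ≠ 1` and
`(ψ⁻¹ω)(p) ≠ 1`, (2) `W` has no prime of split multiplicative reduction, (3) every additive prime
`ℓ ≠ p` of `W` has `ψ(ℓ) ≠ 1` and `(ψ⁻¹ω)(ℓ) ≠ 1` (values of PRIMITIVE characters, `0` off the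
units); an imaginary quadratic field `K` satisfying the Heegner hypothesis for `N` in which `p`
splits, read `p`-adically through `ιp : K →+* ℚ_p`, its quadratic character `ε_K`, modular
parametrisation data `D` at level `N` (`ω_𝓔 = c · ω_E`, `c = D.maninConstant`), a Heegner datum
`H` of level `N` and discriminant `d_K`, a complex embedding `ι` and the Heegner point `P ∈ W(K)`
(`ι(P) = heegnerPointComplex D H`); and assuming **`B_{1,ψ₀⁻¹ε_K} · B_{1,ψ₀ω⁻¹} ≢ 0 (mod p)`**
(`ψ₀ = ψ` or `ψε_K`, whichever is even; Bernoulli numbers of the primitive characters):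
**`(|W̃^{ns}(𝔽_p)|/p) · log_{ω_W} P ≢ 0 (mod p ℤ_p)`**, where
`log_{ω_W} P = padicLogOmega W p ιp P / D.maninConstant` and "`x ≢ 0 (mod p)`" is `¬ ‖x‖_p ≤ p⁻¹`.
NO hypothesis on the reduction of `W` at `p` ("does not require `p ∤ N`", FMS p. 42; Rem. 1.21:
CM by `ℚ(√−p)`; used by the authors at the additive prime `3`, Thm. 10.6). Named fact (PUBLISHED,
refereed); nothing asserted; users take `(h : thm120_padicLogHeegner_unit_of_bernoulli)`.
-- TODO(general form): Thm. 7.1's second alternative (`ψ = 1`) and the `GL₂`-type statement of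
arXiv:1609.06687v3.
[cite: KrizLi2019, Thm. 1.20 (pp. 7–8) = Thm. 7.1 first alternative (pp. 42–43), with §1.4 (p. 4), §1.5 (1) (p. 7), Rem. 1.17 (p. 6), Rem. 1.21 (p. 8), §2 (pp. 11–12), (29) (pp. 49–50) (Forum Math. Sigma 7 (2019) e15, doi 10.1017/fms.2019.9; store paper:url-be4c8b95ec35); = arXiv:1609.06687v3 `thm:mainthm` / `thm:Heegnercorollary`] -/
def thm120_padicLogHeegner_unit_of_bernoulli : Prop :=
  ∀ (p : ℕ) [Fact p.Prime], p ≠ 2 →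
  ∀ (W : WeierstrassCurve ℚ) [W.IsElliptic] [W.IsGloballyMinimal] [NeZero (W.conductorNorm ℤ)]
    (f : ℕ) [NeZero f] (ψ : DirichletCharacter ℚ_[p] f) (ω : DirichletCharacter ℚ_[p] p),
    ψ.IsPrimitive → IsTeichmullerCharacter ω →
    -- `E[p]^{ss} ≅ 𝔽_p(ψ) ⊕ 𝔽_p(ψ⁻¹ω)`: traces of Frobenius at the primes `ℓ ∤ pN`
    (∀ ℓ : ℕ, ℓ.Prime → ¬ (ℓ ∣ p * W.conductorNorm ℤ) →
      ‖((W.LFunction ℓ : ℤ) : ℚ_[p]) -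
          (ψ (ℓ : ZMod f) + ψ⁻¹ (ℓ : ZMod f) * ω (ℓ : ZMod p))‖ < 1) →
    -- (1) `ψ(p) ≠ 1` and `(ψ⁻¹ω)(p) ≠ 1`
    ψ (p : ZMod f) ≠ 1 → primVal (invMulOmega ψ ω) p ≠ 1 →
    -- (2) no prime of split multiplicative reduction
    (∀ ℓ : ℕ, (hℓ : ℓ.Prime) →
      ¬ (haveI := Fact.mk hℓ; W.HasSplitMultiplicativeReductionAtPrime ℓ)) →
    -- (3) additive primes `ℓ ≠ p`
    (∀ ℓ : ℕ, (hℓ : ℓ.Prime) → ℓ ≠ p →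
      (haveI := Fact.mk hℓ;
        ¬ W.HasGoodReductionAtPrime ℓ ∧ ¬ W.HasMultiplicativeReductionAtPrime ℓ) →
      ψ (ℓ : ZMod f) ≠ 1 ∧ primVal (invMulOmega ψ ω) ℓ ≠ 1) →
    ∀ (D : ModularParametrizationData W (W.conductorNorm ℤ))
      (K : Type) [Field K] [NumberField K] [NeZero (NumberField.discr K).natAbs],
      IsImaginaryQuadratic K → SatisfiesHeegnerHypothesis (W.conductorNorm ℤ) K →
      ((Ideal.span {(p : ℤ)}).primesOver (𝓞 K)).ncard = 2 →
    ∀ (εK : DirichletCharacter ℚ_[p] (NumberField.discr K).natAbs), IsKroneckerCharacterOf K εK →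
    ∀ (H : HeegnerDatum (W.conductorNorm ℤ) (NumberField.discr K)) (ι : K →+* ℂ) (ιp : K →+* ℚ_[p])
      (P : (W.baseChange K).toAffine.Point),
      WeierstrassCurve.Affine.Point.map ι.toRatAlgHom P = heegnerPointComplex D H →
    -- `B_{1,ψ₀⁻¹ε_K} · B_{1,ψ₀ω⁻¹} ≢ 0 (mod p)`
    ¬ (‖bernoulliOnePrim (bernoulliCharOne ψ εK) * bernoulliOnePrim (bernoulliCharTwo ψ εK ω)‖ ≤
        (p : ℝ)⁻¹) →
    -- `(|Ẽ^{ns}(𝔽_p)|/p) · log_{ω_E} P ≢ 0 (mod p)`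
    ¬ (‖((nsPointCount W p : ℤ) : ℚ_[p]) / (p : ℚ_[p]) *
          (Castella2018.padicLogOmega W p ιp P / (D.maninConstant : ℚ_[p]))‖ ≤ (p : ℝ)⁻¹)

end Fact

/-! ### §3 Proved API -/

section API

variable {p : ℕ} [Fact p.Prime] {n : ℕ} [NeZero n]

omit [NeZero n] in
/-- The rational weight of `B_{1,χ}` in Diamond–Shurman (4.30) read in `ℚ_p`:
`N⁰ · B₁(c/N) = c/N − ½`. [cite: DiamondShurman2005, §4.7 (4.30), p. 135] -/
theorem algebraMap_genBernoulliCoeff_one (c : ℕ) :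
    algebraMap ℚ ℚ_[p] (genBernoulliCoeff 1 n c) = (c : ℚ_[p]) / n - 2⁻¹ := by
  rw [genBernoulliCoeff_of_one_le le_rfl]
  simp [Polynomial.bernoulli_one]

/-- **The printed formula (1): `B_{1,χ} = (1/f) ∑_{m mod f} χ(m) m` for a non-trivial Dirichlet
character `χ` modulo `f`** (with values in `ℚ_p`; `B_{1,χ}` the tree's `generalizedBernoulli 1`,
`B₁(X) = X − ½` and `∑_m χ(m) = 0`). The representatives are `m = 0, …, f−1`; the printed sum over
`m = 1, …, f` is the same (`χ(f) = χ(0) = 0` for `f > 1`). [cite: KrizLi2019, §1.5 display (1) (p. 7)] -/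
theorem generalizedBernoulli_one_eq_sum_div (χ : DirichletCharacter ℚ_[p] n) (hχ : χ ≠ 1) :
    generalizedBernoulli 1 χ = (∑ j : ZMod n, χ j * (j.val : ℚ_[p])) / n := by
  have h0 : ∑ j : ZMod n, χ j = 0 := MulChar.sum_eq_zero_of_ne_one hχ
  rw [generalizedBernoulli_eq_sum]
  simp_rw [algebraMap_genBernoulliCoeff_one, mul_sub, Finset.sum_sub_distrib, ← Finset.sum_mul, h0,
    zero_mul, sub_zero, Finset.sum_div]
  exact Finset.sum_congr rfl fun j _ ↦ by ring

/-- `bernoulliOnePrim χ` unfolds to `B_{1,χ̃}` of the primitive character `χ̃ = χ.primitiveCharacter`.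
[cite: KrizLi2019, §1.5 display (1) and §2 (primitive characters)] -/
theorem bernoulliOnePrim_def (χ : DirichletCharacter ℚ_[p] n) :
    bernoulliOnePrim χ =
      @generalizedBernoulli ℚ_[p] _ _ χ.conductor ⟨χ.conductor_ne_zero⟩ 1 χ.primitiveCharacter :=
  rfl

/-- Sanity value: for the trivial character (primitive conductor `1`) `bernoulliOnePrim 1 = B₁ = −½`
in Mathlib's convention — the paper's (1) is only ever applied to the two ODD (hence non-trivial)
characters `ψ₀⁻¹ε_K`, `ψ₀ω⁻¹` (Diamond–Shurman §4.7: `B_{k,𝟙₁} = B_k`, here `k = 1`).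
[cite: DiamondShurman2005, §4.7 (4.30), p. 135 (`B_{k,𝟙} = B_k`)] -/
theorem bernoulliOnePrim_one : bernoulliOnePrim (1 : DirichletCharacter ℚ_[p] n) = -2⁻¹ := by
  rw [bernoulliOnePrim_def]
  have h1 : (1 : DirichletCharacter ℚ_[p] n).conductor = 1 := DirichletCharacter.conductor_one
  have key : ∀ (m : ℕ) (hm : (1 : DirichletCharacter ℚ_[p] n).conductor = m) [NeZero m]
      (χ : DirichletCharacter ℚ_[p] m),
      χ = hm ▸ (1 : DirichletCharacter ℚ_[p] n).primitiveCharacter →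
      @generalizedBernoulli ℚ_[p] _ _ (1 : DirichletCharacter ℚ_[p] n).conductor
          ⟨DirichletCharacter.conductor_ne_zero _⟩ 1
          (1 : DirichletCharacter ℚ_[p] n).primitiveCharacter = generalizedBernoulli 1 χ := by
    intro m hm _ χ hχ
    subst hm
    subst hχ
    rfl
  rw [key 1 h1 (h1 ▸ (1 : DirichletCharacter ℚ_[p] n).primitiveCharacter) rfl,
    generalizedBernoulli_modOne, bernoulli_one]
  simp only [map_neg, map_div₀, map_one, map_ofNat]
  norm_num

omit [NeZero n] in
/-- An odd character is non-trivial (`χ(−1) = −1 ≠ 1` in `ℚ_p`), so the printed formula (1)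
applies to "the two odd Dirichlet characters `ψ₀⁻¹ε_K` and `ψ₀ω⁻¹`" (FMS p. 8).
[cite: KrizLi2019, §1.5 (p. 8, "the two odd Dirichlet characters ψ₀⁻¹ε_K and ψ₀ω⁻¹")] -/
theorem ne_one_of_odd {χ : DirichletCharacter ℚ_[p] n} (hχ : χ.Odd) : χ ≠ 1 := by
  intro h
  have h1 : χ (-1) = -1 := hχ
  rw [h, MulChar.one_apply (isUnit_one.neg)] at h1
  norm_num at h1

/-- **From the conclusion of Thm. 1.20: `log_{ω_𝓔} P ≠ 0`** (if the Néron logarithm vanished, the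
displayed quantity would be `0 ≡ 0 (mod p)`); with the injectivity of the formal logarithm modulo
torsion this is the printed "In particular, `P ∈ E(K)` is of infinite order". PROVED from the shape
of the conclusion alone. [cite: KrizLi2019, Thm. 1.20 (p. 8, "In particular, P ∈ E(K) is of infinite order")] -/
theorem padicLogOmega_ne_zero_of_not_norm_le {W : WeierstrassCurve ℚ} [W.IsElliptic]
    [W.IsGloballyMinimal] {K : Type} [Field K] [NumberField K] {ιp : K →+* ℚ_[p]} {P : (W.baseChange K).toAffine.Point} {c : ℤ} {e : ℚ_[p]}
    (h : ¬ ‖e * (Castella2018.padicLogOmega W p ιp P / (c : ℚ_[p]))‖ ≤ (p : ℝ)⁻¹) :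
    Castella2018.padicLogOmega W p ιp P ≠ 0 := by
  intro h0
  apply h
  rw [h0, zero_div, mul_zero, norm_zero]
  positivity

end API

/-! ### §4 Remark 3.10: `p`-integrality of `(|Ẽ^{ns}(𝔽_p)|/p) · log_{ω_E} P`
(the integrality half of "is a `p`-adic unit"; bsd-cm TARGET v4.5 §2 T-U2 `hint` / §8 W18) -/

section Integrality

/-- **Kriz–Li 2019, Remark 3.10 (a REMARK in print, proof = the two-line justification quoted):
the quantity `(|Ẽ^{ns}(𝔽_p)|/p) · log_{ω_E} P` of Theorems 1.16 / 1.20 is `p`-integral.** Verbatim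
(FMS p. 26, §3.4, immediately after the proof of Thm. 3.9 = Thm. 1.16): "The normalizations of
`ω_E` and `ω_{E′}` in the statement of Theorem 1.16 a priori imply that both sides of Theorem 1.16
are `p`-integral. This is because CM points are integrally defined by the theory of CM and the above
proof shows that the rigid analytic function `ι^{#,*} log_{ω_f^{(pNN′/M)}}` has integral
`q`-expansion. Let `ω_𝓔` denote the canonical Néron differential of `E` (as we do in Section 5),
and let `c ∈ ℤ` such that `ω_𝓔 = c · ω_E`. Note that the normalization of the `p`-adic formal
logarithm `log_{ω_E}` above differs by a factor of `c` from that of the normalization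
`log_E := log_{ω_𝓔}`. So we know that `(|Ẽ^{ns}(𝔽_p)|/(p · c)) · log_E P = (|Ẽ^{ns}(𝔽_p)|/p) ·
log_{ω_E} P` is `p`-integral." (Equivalently: Thm. 1.16 with `E′ = E`, where `M = N²` and the
prime set `ℓ ∣ pNN′/M` is `{p}`.) SETTING = that of Thm. 1.16 (§1.4, p. 4): `E/ℚ` of conductor `N`
with NO hypothesis on the reduction at `p` (`p` any prime), `K` imaginary quadratic satisfying the
Heegner hypothesis for `N`, `p` SPLIT in `K`, `P ∈ E(K)` the Heegner point of the modular
parametrisation, `ω_E` the pulled-back one-form; read through `ιp : K →+* ℚ_p` with the SAME symbols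
as `thm116_padicLogHeegner_congruence` / `thm120_padicLogHeegner_unit_of_bernoulli`
(`log_{ω_E} P = padicLogOmega W p ιp P / D.maninConstant`, `|Ẽ^{ns}(𝔽_p)| = nsPointCount W p`), so
that together with Thm. 1.20's "`≢ 0 (mod p)`" it gives "is a `p`-adic UNIT"
(`norm_eq_one_of_rem310`). Vendored at the consumer's request and LABELLED A REMARK: its printed
proof is the parenthetical argument above (integrality of ordinary CM points + integral `q`-expansion
of the rigid function of the proof of Thm. 3.9, itself resting on Thm. 3.8 = Liu–Zhang–Zhang,
Prop. A.1). Named fact; nothing asserted; users take `(h : rem310_padicLogHeegner_integral)`.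
[cite: KrizLi2019, Rem. 3.10 (p. 26), in the setting of Thm. 1.16 / §1.4 (p. 4), Rem. 1.17 (p. 6) and Thm. 3.8–3.9 (pp. 22–26) (Forum Math. Sigma 7 (2019) e15, doi 10.1017/fms.2019.9; store paper:url-be4c8b95ec35 p0026 L30–45); = arXiv:1606.03172 Rem. 2.10] -/
def rem310_padicLogHeegner_integral : Prop :=
  ∀ (p : ℕ) [Fact p.Prime] (W : WeierstrassCurve ℚ) [W.IsElliptic] [W.IsGloballyMinimal]
    [NeZero (W.conductorNorm ℤ)] (D : ModularParametrizationData W (W.conductorNorm ℤ))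
    (K : Type) [Field K] [NumberField K], IsImaginaryQuadratic K →
      SatisfiesHeegnerHypothesis (W.conductorNorm ℤ) K →
      ((Ideal.span {(p : ℤ)}).primesOver (𝓞 K)).ncard = 2 →
    ∀ (H : HeegnerDatum (W.conductorNorm ℤ) (NumberField.discr K)) (ι : K →+* ℂ) (ιp : K →+* ℚ_[p])
      (P : (W.baseChange K).toAffine.Point),
      WeierstrassCurve.Affine.Point.map ι.toRatAlgHom P = heegnerPointComplex D H →
    -- `(|Ẽ^{ns}(𝔽_p)|/p) · log_{ω_E} P ∈ 𝒪_{K_p} = ℤ_p`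
    ‖((nsPointCount W p : ℤ) : ℚ_[p]) / (p : ℚ_[p]) *
        (Castella2018.padicLogOmega W p ιp P / (D.maninConstant : ℚ_[p]))‖ ≤ 1

variable {p : ℕ} [Fact p.Prime]

/-- **Rem. 3.10 ∧ "`≢ 0 (mod p)`" ⇒ "is a `p`-adic unit"**: for the Heegner point of Thm. 1.16's
setting, `p`-integrality (the named fact `rem310_padicLogHeegner_integral`) and the conclusion of
Thm. 1.20 in its printed form `¬ ‖x‖ ≤ p⁻¹` give `‖x‖ = 1` — the form "the `p`-adic logarithm of the
Heegner point is a unit in `ω_E`" used by consumers (bsd-cm T-U2). PROVED (the tree's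
`PadicQuadratic.norm_eq_one_of_not_le`). [cite: KrizLi2019, Rem. 3.10 (p. 26) with Thm. 1.20 (p. 8)] -/
theorem norm_eq_one_of_rem310 (hint : rem310_padicLogHeegner_integral)
    {W : WeierstrassCurve ℚ} [W.IsElliptic] [W.IsGloballyMinimal] [NeZero (W.conductorNorm ℤ)]
    (D : ModularParametrizationData W (W.conductorNorm ℤ))
    {K : Type} [Field K] [NumberField K] (hK : IsImaginaryQuadratic K)
    (hH : SatisfiesHeegnerHypothesis (W.conductorNorm ℤ) K)
    (hsplit : ((Ideal.span {(p : ℤ)}).primesOver (𝓞 K)).ncard = 2)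
    (H : HeegnerDatum (W.conductorNorm ℤ) (NumberField.discr K)) (ι : K →+* ℂ) (ιp : K →+* ℚ_[p])
    {P : (W.baseChange K).toAffine.Point}
    (hP : WeierstrassCurve.Affine.Point.map ι.toRatAlgHom P = heegnerPointComplex D H)
    (hne : ¬ ‖((nsPointCount W p : ℤ) : ℚ_[p]) / (p : ℚ_[p]) *
        (Castella2018.padicLogOmega W p ιp P / (D.maninConstant : ℚ_[p]))‖ ≤ (p : ℝ)⁻¹) :
    ‖((nsPointCount W p : ℤ) : ℚ_[p]) / (p : ℚ_[p]) *
        (Castella2018.padicLogOmega W p ιp P / (D.maninConstant : ℚ_[p]))‖ = 1 :=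
  Literature.NumberTheory.QuadraticFields.PadicQuadratic.norm_eq_one_of_not_le
    (hint p W D K hK hH hsplit H ι ιp P hP) hne

/-- `‖x‖_p = 1 ⇒ ord_p x = 0` in `ℚ_p`. [folklore] -/
private theorem valuation_eq_zero_of_norm_eq_one {x : ℚ_[p]} (h : ‖x‖ = 1) : x.valuation = 0 := by
  have hx : x ≠ 0 := by
    intro h0; rw [h0, norm_zero] at h; exact zero_ne_one h
  have hp_pos : (0 : ℝ) < p := mod_cast (Fact.out : p.Prime).pos
  have hp_ne_one : (p : ℝ) ≠ 1 := mod_cast (Fact.out : p.Prime).ne_one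
  rw [Padic.norm_eq_zpow_neg_valuation hx, ← zpow_zero (p : ℝ), zpow_right_inj₀ hp_pos hp_ne_one,
    neg_eq_zero] at h
  exact h

/-- **The unit statement in `ord_p` bookkeeping**: if `(|Ẽ^{ns}(𝔽_p)|/p) · log_{ω_𝓔} P / c` is a
`p`-adic unit then all three factors are non-zero and
`ord_p |Ẽ^{ns}(𝔽_p)| − 1 + ord_p log_{ω_𝓔} P − ord_p c = 0`, with `ord_p log_{ω_𝓔} P =
padicLogOrd W p ιp P` (`Castella2018.valuation_padicLogOmega`); at an ADDITIVE `p`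
(`|Ẽ^{ns}(𝔽_p)| = p`, Rem. 1.17) this reads `ord_p log_{ω_𝓔} P = ord_p c` (bsd-cm T-U2). PROVED.
[cite: KrizLi2019, Rem. 3.10 (p. 26) and Rem. 1.17 (p. 6) (the normalisations `log_{ω_E} = log_{ω_𝓔}/c`, `|Ẽ^{ns}(𝔽_p)|`)] -/
theorem padicLogOrd_eq_of_norm_eq_one {W : WeierstrassCurve ℚ} [W.IsElliptic] [W.IsGloballyMinimal]
    {K : Type} [Field K] [NumberField K] {ιp : K →+* ℚ_[p]} {P : (W.baseChange K).toAffine.Point}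
    {c : ℤ}
    (h : ‖((nsPointCount W p : ℤ) : ℚ_[p]) / (p : ℚ_[p]) *
        (Castella2018.padicLogOmega W p ιp P / (c : ℚ_[p]))‖ = 1) :
    Castella2018.padicLogOmega W p ιp P ≠ 0 ∧ c ≠ 0 ∧ nsPointCount W p ≠ 0 ∧
      (padicValInt p (nsPointCount W p) : ℤ) - 1 + padicLogOrd W p ιp P - (padicValInt p c : ℤ)
        = 0 := by
  set L := Castella2018.padicLogOmega W p ιp P with hL
  have hx : ((nsPointCount W p : ℤ) : ℚ_[p]) / (p : ℚ_[p]) * (L / (c : ℚ_[p])) ≠ 0 := by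
    intro h0; rw [h0, norm_zero] at h; exact zero_ne_one h
  have hL0 : L ≠ 0 := by
    intro h0; apply hx; rw [h0, zero_div, mul_zero]
  have hc0' : (c : ℚ_[p]) ≠ 0 := by
    intro h0; apply hx; rw [h0, div_zero, mul_zero]
  have hc0 : c ≠ 0 := fun h0 => hc0' (by rw [h0, Int.cast_zero])
  have hn0' : ((nsPointCount W p : ℤ) : ℚ_[p]) ≠ 0 := by
    intro h0; apply hx; rw [h0, zero_div, zero_mul]
  have hn0 : nsPointCount W p ≠ 0 := fun h0 => hn0' (by rw [h0, Int.cast_zero])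
  have hp0 : (p : ℚ_[p]) ≠ 0 := mod_cast (Fact.out : p.Prime).ne_zero
  refine ⟨hL0, hc0, hn0, ?_⟩
  have hv := valuation_eq_zero_of_norm_eq_one h
  rw [Padic.valuation_mul (div_ne_zero hn0' hp0) (div_ne_zero hL0 hc0'), div_eq_mul_inv,
    div_eq_mul_inv, Padic.valuation_mul hn0' (inv_ne_zero hp0),
    Padic.valuation_mul hL0 (inv_ne_zero hc0'), Padic.valuation_inv, Padic.valuation_inv,
    Padic.valuation_p, Padic.valuation_intCast, Padic.valuation_intCast,
    Castella2018.valuation_padicLogOmega hL0] at hv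
  linarith

end Integrality

/-! ### §5 The Teichmüller character modulo `p²` (bridge from the binder `IsTeichmullerCharacter ω`
to the ELEMENTARY form of the Bernoulli hypothesis `ω(m) ≡ m^p (mod p²)`; bsd-cm TARGET v4.6 §2 T-U3′) -/

section Teichmuller

variable {p : ℕ} [Fact p.Prime]

/-- **The values of a character mod `p` at units are `(p−1)`-th roots of unity**: for `p ∤ a`,
`ω(a)^{p−1} = ω(a^{p−1}) = ω(1) = 1` (Fermat in `(ℤ/p)^×`). PROVED; it is the printed "`ω :
(ℤ/p)^× → μ_{p−1}`" / "`V` is a cyclic group of order `p − 1`" for ANY `ℚ_p`-valued Dirichlet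
character of level `p`. [cite: Gouvea1993PadicNumbers, §5.8 (Cor. 5.8.2 and the Teichmüller character `ω : 𝔽_p^× ≅ V ↪ ℤ_p^×`, printed pp. 153–154 = pdf pp. 128–129)] [cite: KrizLi2019, §1.5 (p. 7) (`ψ : (ℤ/f)^× → μ_{p−1}`, `ω` the Teichmüller character)] -/
theorem apply_pow_sub_one_eq_one (ω : DirichletCharacter ℚ_[p] p) (a : ℤ) (ha : ¬ ((p : ℤ) ∣ a)) :
    ω (a : ZMod p) ^ (p - 1) = 1 := by
  have h0 : (a : ZMod p) ≠ 0 := by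
    rwa [Ne, ZMod.intCast_zmod_eq_zero_iff_dvd]
  rw [← map_pow, ZMod.pow_card_sub_one_eq_one h0, map_one]

/-- **Hence `‖ω(a)‖_p = 1` for `p ∤ a`** (a `(p−1)`-th root of unity is a `p`-adic unit). PROVED.
[cite: Gouvea1993PadicNumbers, §5.8 (V ⊂ ℤ_p^× the roots of unity, printed pp. 153–154)] -/
theorem norm_apply_eq_one (ω : DirichletCharacter ℚ_[p] p) (a : ℤ) (ha : ¬ ((p : ℤ) ∣ a)) :
    ‖ω (a : ZMod p)‖ = 1 := by
  have h := congrArg (‖·‖) (apply_pow_sub_one_eq_one ω a ha)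
  simp only [norm_pow, norm_one] at h
  have hp1 : p - 1 ≠ 0 := Nat.sub_ne_zero_of_lt (Fact.out : p.Prime).one_lt
  exact (pow_eq_one_iff_of_nonneg (norm_nonneg _) hp1).mp h

/-- **The Teichmüller character modulo `p²`: `ω(a)^k ≡ a^{pk} (mod p²)` for `p ∤ a`, `k ≥ 0`.**
From the binder `IsTeichmullerCharacter ω` (`ω(a) ≡ a (mod p)`): `ω(a) = ω(a)^p ≡ a^p (mod p²)`
(`x ≡ y (mod p) ⇒ x^p ≡ y^p (mod p²)`, Mathlib's `dvd_sub_pow_of_dvd_sub` in `ℤ_p`), then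
`x − y ∣ x^k − y^k`. This is the bridge between the fact's hypothesis
`¬ ‖B_{1,χ₁} B_{1,χ₂}‖ ≤ p⁻¹` (characters built from `ω`) and the ELEMENTARY certificates
"`Σ χ_q(m) m^{pa+1} mod p²`" of the consumer (bsd-cm T-U3′/T-U4: with `generalizedBernoulli_one_eq_sum_div`
and `p ∥ f`, `ω^a(m)·m` may be replaced by `m^{pa+1}` modulo `p²`). PROVED.
[cite: Gouvea1993PadicNumbers, §5.8 (Teichmüller character: `ω(n) ≡ n (mod p)`, `x = ω(x)·x₁`, printed pp. 153–154)] [cite: KrizLi2019, §8 (35) and (1) (pp. 7, 52) (the Bernoulli numbers `B_{1,ψ} = f⁻¹ Σ ψ(m) m` whose `p`-adic units are at stake)] -/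
theorem IsTeichmullerCharacter.norm_pow_sub_pow_le {ω : DirichletCharacter ℚ_[p] p}
    (hω : IsTeichmullerCharacter ω) (a : ℤ) (ha : ¬ ((p : ℤ) ∣ a)) (k : ℕ) :
    ‖ω (a : ZMod p) ^ k - ((a : ℚ_[p]) ^ p) ^ k‖ ≤ (p : ℝ) ^ (-2 : ℤ) := by
  have hx1 : ‖ω (a : ZMod p)‖ = 1 := norm_apply_eq_one ω a ha
  set X : ℤ_[p] := ⟨ω (a : ZMod p), hx1.le⟩ with hX
  set A : ℤ_[p] := (a : ℤ_[p]) with hA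
  have hXA : (p : ℤ_[p]) ∣ X - A := by
    rw [← PadicInt.norm_lt_one_iff_dvd, PadicInt.norm_def, PadicInt.coe_sub]
    simpa [hX, hA] using hω a ha
  -- `p² ∣ X^p − A^p`
  have h2 : (p : ℤ_[p]) ^ 2 ∣ X ^ p - A ^ p := by
    simpa using dvd_sub_pow_of_dvd_sub hXA 1
  -- `X^p = X`
  have hXp : X ^ p = X := by
    have h1 : X ^ (p - 1) = 1 := by
      apply Subtype.ext
      rw [PadicInt.coe_pow]; simpa [hX] using apply_pow_sub_one_eq_one ω a ha
    calc X ^ p = X ^ (p - 1 + 1) := by rw [Nat.sub_add_cancel (Fact.out : p.Prime).one_lt.le]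
      _ = X := by rw [pow_succ, h1, one_mul]
  rw [hXp] at h2
  have hk : (p : ℤ_[p]) ^ 2 ∣ X ^ k - (A ^ p) ^ k :=
    dvd_trans h2 (sub_dvd_pow_sub_pow X (A ^ p) k)
  have hn : ‖X ^ k - (A ^ p) ^ k‖ ≤ (p : ℝ) ^ (-(2 : ℕ) : ℤ) := by
    rw [PadicInt.norm_le_pow_iff_mem_span_pow, Ideal.mem_span_singleton]
    exact hk
  rw [PadicInt.norm_def] at hn
  simpa [hX, hA] using hn

/-- The case `k = 1`: **`ω(a) ≡ a^p (mod p²)`**. PROVED.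
[cite: Gouvea1993PadicNumbers, §5.8 (Teichmüller character, printed pp. 153–154)] -/
theorem IsTeichmullerCharacter.norm_sub_pow_le {ω : DirichletCharacter ℚ_[p] p}
    (hω : IsTeichmullerCharacter ω) (a : ℤ) (ha : ¬ ((p : ℤ) ∣ a)) :
    ‖ω (a : ZMod p) - (a : ℚ_[p]) ^ p‖ ≤ (p : ℝ) ^ (-2 : ℤ) := by
  simpa using hω.norm_pow_sub_pow_le a ha 1

end Teichmuller

/-! ### §6 Theorem 7.1, second alternative (`ψ = 1`): the trivial-character Eisenstein case
(appended 2026-08-27, cell `bsd-print-cfram`, seat ty1; the `TODO(general form)` of §2 for odd `p`)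

THE PRINTED STATEMENT (journal = store `paper:url-be4c8b95ec35`, p. 42 L33 – p. 43 L18, VERBATIM;
the extraction loses the bar of `ᾱ`, restored from the authors' TeX arXiv:1609.06687v3
`thm:Heegnercorollary`): "THEOREM 7.1. Let `E/ℚ` be an elliptic curve. Let `p` be a prime such that
`E[p]` is a reducible `Gal(ℚ̄/ℚ)`-representation, or equivalently, `E[p]^{ss} ≅ 𝔽_p(ψ) ⊕ 𝔽_p(ψ⁻¹ω)`,
for some character `ψ : Gal(ℚ̄/ℚ) → μ_{p−1}`. Let `K` be an imaginary quadratic field satisfying the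
Heegner hypothesis for `N`. Suppose `p` splits in `K`. Suppose further that either the following four
conditions hold: [(1)–(4) of the first alternative = Thm. 1.20, §2 above] or the following four
conditions hold: (1) `ψ = 1`, (2) `p | N`, (3) `ℓ | N, ℓ ≠ p` implies `ℓ ∥ N`, `ℓ ≡ −1 (mod p)`,
`ℓ ≢ 1 (mod p)` (4) `ord_p(((p−1)/2p) log_p ᾱ) = 0`, where `α ∈ 𝒪_K^×` [sic: `α ∈ 𝒪_K`] and
`(α) = 𝔭^{h_K}`, `ᾱ` is its complex conjugate and `log_p` is the Iwasawa `p`-adic logarithm. Let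
`P ∈ E(K)` be the associated Heegner point. Then `(|Ẽ^{ns}(𝔽_p)|/p) · log_{ω_E} P ≠ 0 (mod p)`. In
particular, `P ∈ E(K)` is of infinite order and `E/K` has analytic and algebraic rank `1`."
REMARK 7.2 (p. 43 L19–21): "When `p = 2`, we must have `ψ = 1` … by (3) of the second part of
Theorem 7.1, in this case, `N` must be a power of `2`."

ITS PROOF (what the transcription must not outrun). The second alternative is §7.4–7.5: Lemma 7.6
with formula (28) `L_p^{Katz}(𝐍_K, 0) = (4/|𝒪_K^×|) · ((p−1)/p) · log_p(α) = 2 · ((p−1)/p) · log_p(α)`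
"since we assume `d_K < −4` and hence `|𝒪_K^×| = 2`" (p. 49 L33–41) — a STANDING ASSUMPTION of the
proof absent from the display; the main congruence (30) (p. 50 L14–35):
`(|Ẽ^{ns}(𝔽_p)|/p) · log_{ω_E} P ≡ ∏_{ℓ∣N₋, ℓ≠p} (1 − 1/ℓ) · ((p−1)/(2p)) log_p α (mod p𝒪_{ℂ_p})`
"if `ℓ | N₊N₀ ⟹ ℓ = p`", and `≡ 0` "if `∃ ℓ ≠ p` such that `ℓ | N₊N₀`", "where `(α) = 𝔭^{h_K}` and
`log_p` is the Iwasawa `p`-adic logarithm (that is, the locally analytic function defined by the usual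
power series `log(1 + x) = x − x²/2 + x³/3 − ⋯`, and then uniquely extended to all of `ℂ_p^×` by
defining `log_p p = 0`)"; and Lemma 7.7 (p. 50 L37 – p. 51 L12), whose proof reads condition (3) as
"`ℓ ∤ N₀`, `ℓ ∤ N₊`" (p. 51 L8) for the decomposition `N = N₊N₋N₀` of Lemma 7.4 (p. 44 L11–16:
"(1) if `ℓ | N₊`, then `a_ℓ(f) ≡ ψ(ℓ)`; (2) if `ℓ | N₋`, then `a_ℓ(f) ≡ ψ⁻¹(ℓ)ℓ`; (3) if `ℓ | N₀`,
then `a_ℓ(f) = 0`"; for `E`: `N₊ = N_{split}`, `N₋ = N_{nonsplit}`, `N₀ = N_{add}`, p. 42 top /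
arXiv v3 §7 "we can take `N₊ = N_{split}, N₋ = N_{nonsplit}` and `N₀ = N_{add}`"). With `ψ = 1`,
`ℓ ∈ N₋` requires `a_ℓ ≡ ℓ (mod p)`, so for `p` odd a prime `ℓ ∥ N` with `ℓ ≡ −1 (mod p)` is in
`N₋` iff `a_ℓ = −1` (NONSPLIT); a split multiplicative `ℓ ≡ −1 (mod p)` lies in `N₊` and makes the
right side of (30) vanish. The first alternative prints this clause as "(2) `N_{split} = 1`"; the
second alternative's display does not repeat it. Also `(α)(ᾱ) = (p)^{h_K}`, so
`log_p α = −log_p ᾱ` (Iwasawa normalisation): (28)/(30)'s `α` and the display's `ᾱ` give the same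
condition (4); we keep `ᾱ`, a `𝔭`-adic UNIT, so that only the logarithm on `ℤ_p^×` is used.
-/

section TrivialChar

/-- **Kriz–Li 2019, Theorem 7.1, second alternative (`ψ = 1`): non-vanishing mod `p` of the
`p`-adic logarithm of the Heegner point at an Eisenstein prime `p ∣ N` with TRIVIAL isogeny
character, from the `p`-adic logarithm of a generator of `𝔭^{h_K}`.** For an odd prime `p`; a
globally minimal elliptic curve `W/ℚ` of conductor `N` with **(1) `ψ = 1`**, i.e.
`E[p]^{ss} ≅ 𝔽_p ⊕ 𝔽_p(ω)`, transcribed (as in `thm120_…` and `HeegnerLogCongruence.lean`) by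
TRACES OF FROBENIUS: `a_ℓ(W) ≡ 1 + ℓ (≡ ψ(ℓ) + ψ⁻¹(ℓ)ω(ℓ)) (mod p)` for every prime `ℓ ∤ pN`
(`‖a_ℓ − (1 + ℓ)‖_p < 1`; equivalent to the printed hypothesis by Chebotarev + Brauer–Nesbitt);
**(2) `p ∣ N`**; **(3)** every prime `ℓ ≠ p` dividing `N` has `ℓ ∥ N` (`ℓ² ∤ N`),
`ℓ ≡ −1 (mod p)` and `ℓ ≢ 1 (mod p)` — AS PRINTED — AND is not a prime of split multiplicative
reduction (`ℓ ∤ N₊ = N_{split}`: the clause the proof of Lemma 7.7 uses, p. 51 L8, see the section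
docstring; printed as (2) `N_{split} = 1` in the first alternative); an imaginary quadratic field `K`
with **`d_K < −4`** (the proof's standing assumption, p. 49 L41, formula (28)) satisfying the Heegner
hypothesis for `N`, in which `p` splits, read `p`-adically through `ιp : K →+* ℚ_p`; modular
parametrisation data `D` at level `N` (`ω_𝓔 = c · ω_E`, `c = D.maninConstant`), a Heegner datum `H`
of level `N` and discriminant `d_K`, a complex embedding `ι` and the Heegner point `P ∈ W(K)`
(`ι(P) = heegnerPointComplex D H`) — LITERALLY the binders of `thm120_…`; and **(4)
`ord_p(((p − 1)/(2p)) · log_p ᾱ) = 0`**: for the prime `𝔭` of `K` above `p` singled out by `ιp`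
(`‖ιp x‖ < 1` on `𝔭`; "fixing `ℚ̄_p` amounts to fixing a prime of `ℚ̄` above `p`", §2 p. 11), ANY
`α ∈ 𝒪_K` with `(α) = 𝔭^{h_K}` (`h_K = classNumber K`; two such `α` differ by a root of unity,
killed by `log_p`) and `ᾱ = τ α` for the non-trivial automorphism `τ` of `K`, the element
`((p−1)/(2p)) · log_p(ιp ᾱ) ∈ ℚ_p` is a UNIT (`‖·‖_p = 1`, i.e. `ord_p = 0`), `log_p` = the tree's
Iwasawa logarithm `padicLog p` on `ℚ_p` (`ιp ᾱ ∈ ℤ_p^×` since `ᾱ ∉ 𝔭`); for `p` odd this says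
`ord_p log_p(ιp ᾱ) = 1` (`norm_prefactor_mul_eq_one_iff`). CONCLUSION (same term as `thm120_…`):
**`(|W̃^{ns}(𝔽_p)|/p) · log_{ω_W} P ≢ 0 (mod p ℤ_p)`**, `log_{ω_W} P = padicLogOmega W p ιp P /
D.maninConstant`, "`x ≢ 0 (mod p)`" = `¬ ‖x‖_p ≤ p⁻¹`. No hypothesis on the reduction type of `W`
at `p` beyond `p ∣ N` ("does not require `p ∤ N`", p. 42). Named fact (PUBLISHED, refereed);
nothing asserted; users take `(h : thm71_padicLogHeegner_unit_of_trivialChar)`. Scope for the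
requesting cell: `j = 0` curves are additive at every bad prime, so (3) forces `N = 3^a` at `p = 3`
(window class 243a; 27a has rank `0`).
-- TODO(general form): `p = 2` (printed: "Let `p` be a prime"; Rem. 7.2: then `N` is a power of `2`)
and the `GL₂`-type statement of arXiv:1609.06687v3 (`ord_λ`, `A[λ]`).
[cite: KrizLi2019, Thm. 7.1 second alternative (pp. 42–43: p. 42 L33–39, p. 43 L1–18), Rem. 7.2 (p. 43), Lemma 7.4 (p. 44 L11–16), §7.4 (28) (p. 49 L20–41, «d_K < −4»), §7.5 (30) and Lemma 7.7 (p. 50 L14 – p. 51 L12) (Forum Math. Sigma 7 (2019) e15, doi 10.1017/fms.2019.9; store paper:url-be4c8b95ec35); = arXiv:1609.06687v3 `thm:Heegnercorollary`, second list of conditions]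
[cite: Iwasawa1972PadicL, §4.4 (the logarithm `log_p`, `log_p p = 0`)] -/
def thm71_padicLogHeegner_unit_of_trivialChar : Prop :=
  ∀ (p : ℕ) [Fact p.Prime], p ≠ 2 →
  ∀ (W : WeierstrassCurve ℚ) [W.IsElliptic] [W.IsGloballyMinimal] [NeZero (W.conductorNorm ℤ)],
    -- (1) `ψ = 1`: `E[p]^{ss} ≅ 𝔽_p ⊕ 𝔽_p(ω)` — traces of Frobenius at the primes `ℓ ∤ pN`
    (∀ ℓ : ℕ, ℓ.Prime → ¬ (ℓ ∣ p * W.conductorNorm ℤ) →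
      ‖((W.LFunction ℓ : ℤ) : ℚ_[p]) - (1 + (ℓ : ℚ_[p]))‖ < 1) →
    -- (2) `p ∣ N`
    p ∣ W.conductorNorm ℤ →
    -- (3) `ℓ ∣ N`, `ℓ ≠ p` ⟹ `ℓ ∥ N`, `ℓ ≡ −1 (mod p)`, `ℓ ≢ 1 (mod p)` — and `ℓ ∤ N₊ = N_split`
    (∀ ℓ : ℕ, (hℓ : ℓ.Prime) → ℓ ∣ W.conductorNorm ℤ → ℓ ≠ p →
      ¬ (ℓ ^ 2 ∣ W.conductorNorm ℤ) ∧ ((ℓ : ZMod p) = -1 ∧ (ℓ : ZMod p) ≠ 1) ∧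
        ¬ (haveI := Fact.mk hℓ; W.HasSplitMultiplicativeReductionAtPrime ℓ)) →
    ∀ (D : ModularParametrizationData W (W.conductorNorm ℤ))
      (K : Type) [Field K] [NumberField K],
      IsImaginaryQuadratic K → NumberField.discr K < -4 →
      SatisfiesHeegnerHypothesis (W.conductorNorm ℤ) K →
      ((Ideal.span {(p : ℤ)}).primesOver (𝓞 K)).ncard = 2 →
    ∀ (H : HeegnerDatum (W.conductorNorm ℤ) (NumberField.discr K)) (ι : K →+* ℂ) (ιp : K →+* ℚ_[p])
      (P : (W.baseChange K).toAffine.Point),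
      WeierstrassCurve.Affine.Point.map ι.toRatAlgHom P = heegnerPointComplex D H →
    -- (4) `ord_p(((p − 1)/(2p)) · log_p ᾱ) = 0`, `(α) = 𝔭^{h_K}`, `𝔭` the prime above `p` under `ιp`
    ∀ (𝔭 : Ideal (𝓞 K)) (α : 𝓞 K) (τ : K ≃ₐ[ℚ] K),
      𝔭 ∈ (Ideal.span {(p : ℤ)}).primesOver (𝓞 K) → (∀ x : 𝓞 K, x ∈ 𝔭 → ‖ιp x‖ < 1) →
      Ideal.span {α} = 𝔭 ^ NumberField.classNumber K → τ ≠ 1 →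
      ‖((p : ℚ_[p]) - 1) / (2 * p) * padicLog p (ιp (τ (α : K)))‖ = 1 →
    -- `(|Ẽ^{ns}(𝔽_p)|/p) · log_{ω_E} P ≢ 0 (mod p)`
    ¬ (‖((nsPointCount W p : ℤ) : ℚ_[p]) / (p : ℚ_[p]) *
          (Castella2018.padicLogOmega W p ιp P / (D.maninConstant : ℚ_[p]))‖ ≤ (p : ℝ)⁻¹)

variable {p : ℕ} [Fact p.Prime]

/-- **Feeding hypothesis (1) from an integer congruence**: `a ≡ 1 + ℓ (mod p)` in `ℤ` gives the
trace form `‖a − (1 + ℓ)‖_p < 1` of `thm71_…` (for `j = 0` curves at `p = 3` the congruence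
`a_ℓ ≡ (d/ℓ)(ℓ + 1) (mod 3)` with `d` a square is of this shape). PROVED (Mathlib
`Padic.norm_intCast_lt_one_iff`). [cite: KrizLi2019, Thm. 7.1 (p. 42 L33–35: "E[p]^{ss} ≅ 𝔽_p(ψ) ⊕ 𝔽_p(ψ⁻¹ω)") with Lemma 7.4 (p. 44)] -/
theorem traceForm_one_of_dvd {a : ℤ} {ℓ : ℕ} (h : (p : ℤ) ∣ a - (1 + ℓ)) :
    ‖((a : ℤ) : ℚ_[p]) - (1 + (ℓ : ℚ_[p]))‖ < 1 := by
  have hcast : ((a : ℤ) : ℚ_[p]) - (1 + (ℓ : ℚ_[p])) = ((a - (1 + ℓ) : ℤ) : ℚ_[p]) := by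
    push_cast; ring
  rw [hcast]
  exact Padic.norm_intCast_lt_one_iff.mpr h

/-- **Reading hypothesis (4) for odd `p`**: `‖((p − 1)/(2p)) · L‖_p = 1 ↔ ‖L‖_p = p⁻¹`
(`p − 1` and `2` are `p`-adic units, `‖p‖_p = p⁻¹`), i.e. `ord_p(((p−1)/(2p)) log_p ᾱ) = 0` iff
`ord_p log_p ᾱ = 1`. PROVED. [cite: KrizLi2019, Thm. 7.1 second alternative, condition (4) (p. 43 L10–13)] -/
theorem norm_prefactor_mul_eq_one_iff (hp2 : p ≠ 2) (L : ℚ_[p]) :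
    ‖((p : ℚ_[p]) - 1) / (2 * p) * L‖ = 1 ↔ ‖L‖ = (p : ℝ)⁻¹ := by
  have hp0 : 0 < (p : ℝ) := Nat.cast_pos.mpr (Fact.out : p.Prime).pos
  -- `‖p − 1‖ = 1`
  have h1 : ‖(p : ℚ_[p]) - 1‖ = 1 := by
    have hcast : (p : ℚ_[p]) - 1 = (((p : ℤ) - 1 : ℤ) : ℚ_[p]) := by push_cast; ring
    rw [hcast]
    refine le_antisymm (Padic.norm_int_le_one _) (not_lt.mp fun hlt ↦ ?_)
    rw [Padic.norm_intCast_lt_one_iff] at hlt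
    have : (p : ℤ) ∣ 1 := by simpa using dvd_sub (dvd_refl (p : ℤ)) hlt
    exact (Fact.out : p.Prime).ne_one (by exact_mod_cast Int.eq_one_of_dvd_one (by positivity) this)
  -- `‖2‖ = 1`
  have h2 : ‖(2 : ℚ_[p])‖ = 1 := by
    have hcast : (2 : ℚ_[p]) = ((2 : ℤ) : ℚ_[p]) := by norm_num
    rw [hcast]
    refine le_antisymm (Padic.norm_int_le_one _) (not_lt.mp fun hlt ↦ ?_)
    rw [Padic.norm_intCast_lt_one_iff] at hlt
    have h2' : (p : ℤ) ∣ (2 : ℕ) := by exact_mod_cast hlt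
    have := (Nat.prime_dvd_prime_iff_eq (Fact.out : p.Prime) Nat.prime_two).mp (by exact_mod_cast h2')
    exact hp2 this
  rw [norm_mul, norm_div, h1, norm_mul, h2, Padic.norm_p, one_mul, one_div, inv_inv]
  constructor
  · intro h
    have : ‖L‖ = (p : ℝ)⁻¹ * ((p : ℝ) * ‖L‖) := by
      rw [← mul_assoc, inv_mul_cancel₀ hp0.ne', one_mul]
    rw [this, h, mul_one]
  · intro h
    rw [h, mul_inv_cancel₀ hp0.ne']

end TrivialChar

end Literature.NumberTheory.EllipticCurves.KrizLi2019

end
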